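import Mathlib
import HarnessLib
import Literature.NumberTheory.Transcendental.KZKernelConjectureForms
import Literature.NumberTheory.Transcendental.KZUnfolding
import Literature.NumberTheory.Transcendental.MZVSimplexRep
import Summits.KontsevichZagierPeriods.KontsevichZagierPeriods.Theses.LinRedNormalForm

/-!
# Route LinRedNormalForm, item `ResidualBeyondGenusZero` (stmt-KontsevichZagierPeriods-3917): the residual is a statement about representations of `0`

The support item `ResidualBeyondGenusZero` of route LinRedNormalForm — "every vanishing formal
`ℤ`-combination of integral representations is congruent modulo `KZ.relations` to a `ℤ`-combination
of genus-zero representations" — is the route's DECLARED RESIDUAL; it is summit-strength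
(`LinRedNormalFormResidualBeyondGenusZeroStrength.lean`: `KontsevichZagierPeriods → Residual`, and
the converse granted the sector cruxes) and its lattice / two-representation / obstruction forms are
in `LinRedNormalFormResidualBeyondGenusZeroForms.lean`. This file adds, sorry-free and
unconditionally, the sharpest readings, which say exactly which instances of Conjecture 1 the item
IS:

* `exists_sub_of_mem_relations` — bookkeeping: every formal `ℤ`-combination `c` is ONE integral
  representation modulo the moves, `c ≡ [R]` (difference form `KZ.exists_integralRep_sub`, free
  cancellation `[r'] + [r'.neg] ∈ levelRel ≤ relations`, and merging of a sum into one
  representation `KZ.IntegralRep.exists_of_add_of_sub_of_mem_relations`);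
* `residualBeyondGenusZero_iff_value_eq_zero` — ONE-REPRESENTATION FORM: the item holds iff every
  single integral representation OF THE NUMBER `0` (any dimension, any `ℚ`-semialgebraic domain and
  integrand, e.g. `∫_σ f = 0` with `f` changing sign, or a difference of an elliptic and a
  hypergeometric formula for the same number glued into one domain) is congruent modulo the moves
  to a `ℤ`-combination of genus-zero simplex representations — Conjecture 1 of Kontsevich–Zagier
  for the representations of zero, weakened only by a genus-zero error term;
* `residualBeyondGenusZero_iff_mem_sup_of_eval_mem`, `residualBeyondGenusZero_iff_of_mem_sup` —
  VALUE-CLASS FORMS: the item holds iff every combination (resp. every single representation) whose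
  VALUE lies in the `ℤ`-module of genus-zero values lies in `relations ⊔ ⟨genus-zero⟩`, i.e. is
  move-equivalent to a genus-zero combination: Conjecture 1 modulo genus zero for every
  representation, of whatever geometric origin, of a number that happens to be a genus-zero value
  (a `ℚ`-combination of multiple zeta values by Brown's theorem on `M_{0,n}`, not used here);
* `residualBeyondGenusZero_iff_comap_map` — SATURATION FORM: the item holds iff the subgroup
  `relations ⊔ ⟨genus-zero⟩` is saturated for `eval`, `eval⁻¹(eval(⟨genus-zero⟩)) = relations ⊔
  ⟨genus-zero⟩`;
* `exists_genusZero_value_eq_ratCast`, `of_mem_sup_of_value_eq_ratCast` — a concrete family of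
  instances: every rational number is a genus-zero value (dimension `0`, the base case "`w = 0`
  gives the constants" of the route's normal forms), so under the item EVERY integral
  representation of a rational number, of whatever shape and dimension, is move-equivalent to a
  genus-zero combination.

So the item quantifies over all integral representations of all dimensions and shapes; nothing in it
is confined to the genus-zero sector except the error term, which is why neither it nor its
negation is accessible short of Conjecture 1 over the fixed calculus.

References: M. Kontsevich, D. Zagier, *Periods* (2001), §1.2, Conjecture 1; A. Huber,
S. Müller-Stach, *Periods and Nori Motives* (2017), Conj. 13.2.1, Rem. 13.2.2.
-/

noncomputable section

namespace Summit.KontsevichZagierPeriods.ResidualBeyondGenusZero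

open Literature.NumberTheory.Transcendental
open Summit.KontsevichZagierPeriods.KontsevichZagierPeriods.Theses.LinRedNormalForm

/-- **Every formal combination is one representation modulo the moves.** For every
`c : KZ.FormalRep` there is a single integral representation `R` (in some dimension) with
`c - [R] ∈ relations`: write `c ≡ [r] - [r']` (`KZ.exists_integralRep_sub_holds`), replace `-[r']`
by `[r'.neg]` (free cancellation `[r'] + [r'.neg] ∈ levelRel ≤ relations`,
`KZ.of_add_of_neg_mem_levelRel`), and merge `[r] + [r'.neg]` into one representation by slabs at
disjoint levels glued by domain additivity (`KZ.IntegralRep.exists_of_add_of_sub_of_mem_relations`).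
[Kontsevich–Zagier 2001, §1.2 (rules 1–3); folklore bookkeeping] -/
theorem exists_sub_of_mem_relations (c : KZ.FormalRep) :
    ∃ (N : ℕ) (R : KZ.IntegralRep N), c - KZ.of R ∈ KZ.relations := by
  obtain ⟨n, m, r, r', h⟩ := KZ.exists_integralRep_sub_holds c
  obtain ⟨N, R, hR⟩ := r.exists_of_add_of_sub_of_mem_relations r'.neg
  have hneg : KZ.of r' + KZ.of r'.neg ∈ KZ.relations :=
    KZ.levelRel_le_relations (KZ.of_add_of_neg_mem_levelRel r')
  refine ⟨N, R, ?_⟩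
  have : c - KZ.of R = (c - (KZ.of r - KZ.of r')) + (KZ.of r + KZ.of r'.neg - KZ.of R) -
      (KZ.of r' + KZ.of r'.neg) := by
    abel
  rw [this]
  exact sub_mem (add_mem h hR) hneg

/-- **One-representation form.** `ResidualBeyondGenusZero` holds if and only if every integral
representation `R` of the number `0` (`R.value = 0`; any dimension, any `ℚ`-semialgebraic data) is
congruent modulo the moves to a `ℤ`-combination of genus-zero representations. (⇒): apply the
item to `c = [R]`, `eval [R] = R.value = 0`. (⇐): for `eval c = 0` pick `R` with
`c - [R] ∈ relations` (`exists_sub_of_mem_relations`); soundness (`KZ.relations_le_ker_eval_holds`)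
gives `R.value = eval c = 0`, and `c - c₀ = (c - [R]) + ([R] - c₀)`. This is Conjecture 1 of
Kontsevich–Zagier 2001, §1.2, for the representations of zero, with a genus-zero error term.
[folklore] -/
theorem residualBeyondGenusZero_iff_value_eq_zero :
    ResidualBeyondGenusZero ↔
      ∀ ⦃N : ℕ⦄ (R : KZ.IntegralRep N), R.value = 0 →
        ∃ c₀ ∈ AddSubgroup.closure
          {x : KZ.FormalRep | ∃ (k : ℕ) (r : KZ.IntegralRep k)
            (p : MvPolynomial (Fin k) ℚ) (a : Fin k → Fin k → ℕ) (b c : Fin k → ℕ),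
            r.domain = {t | (∀ i, 0 < t i) ∧ (∀ i, t i < 1) ∧ StrictAnti t} ∧
            Set.EqOn r.integrand (fun t => MvPolynomial.aeval t p / ((∏ i, t i ^ b i) *
              (∏ i, (1 - t i) ^ c i) * ∏ i, ∏ j, if i < j then (t i - t j) ^ a i j else 1))
              r.domain ∧ x = KZ.of r},
          KZ.of R - c₀ ∈ KZ.relations := by
  constructor
  · intro hRES N R hR
    exact hRES (KZ.of R) (by rw [KZ.eval_of, hR])
  · intro h c hc
    obtain ⟨N, R, hcR⟩ := exists_sub_of_mem_relations c
    have hker : KZ.eval (c - KZ.of R) = 0 := KZ.relations_le_ker_eval_holds hcR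
    rw [map_sub, hc, zero_sub, neg_eq_zero, KZ.eval_of] at hker
    obtain ⟨c₀, hc₀, hRc₀⟩ := h R hker
    refine ⟨c₀, hc₀, ?_⟩
    have key := add_mem hcR hRc₀
    rwa [sub_add_sub_cancel] at key

/-- **Value-class form.** `ResidualBeyondGenusZero` holds if and only if every formal combination
whose VALUE is the value of some `ℤ`-combination of genus-zero representations lies in
`relations ⊔ closure (genus-zero representations)`, i.e. is itself congruent modulo the moves to a
genus-zero combination. (⇒): if `eval c = eval g` with `g` in the closure, the item applied to
`c - g` gives `c₀` with `c - g - c₀ ∈ relations`, and `c = (c - g - c₀) + (g + c₀)`. (⇐): for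
`eval c = 0 = eval 0` the hypothesis gives `c = y + z`, `y ∈ relations`, `z` in the closure
(`AddSubgroup.mem_sup`), and `c - z = y`. So the item is Conjecture 1 modulo genus zero for every
representation — of any geometric origin — of a number lying in the genus-zero value module.
[folklore] -/
theorem residualBeyondGenusZero_iff_mem_sup_of_eval_mem :
    ResidualBeyondGenusZero ↔
      ∀ c : KZ.FormalRep,
        KZ.eval c ∈ (AddSubgroup.closure
          {x : KZ.FormalRep | ∃ (k : ℕ) (r : KZ.IntegralRep k)
            (p : MvPolynomial (Fin k) ℚ) (a : Fin k → Fin k → ℕ) (b c : Fin k → ℕ),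
            r.domain = {t | (∀ i, 0 < t i) ∧ (∀ i, t i < 1) ∧ StrictAnti t} ∧
            Set.EqOn r.integrand (fun t => MvPolynomial.aeval t p / ((∏ i, t i ^ b i) *
              (∏ i, (1 - t i) ^ c i) * ∏ i, ∏ j, if i < j then (t i - t j) ^ a i j else 1))
              r.domain ∧ x = KZ.of r}).map KZ.eval →
        c ∈ KZ.relations ⊔ AddSubgroup.closure
          {x : KZ.FormalRep | ∃ (k : ℕ) (r : KZ.IntegralRep k)
            (p : MvPolynomial (Fin k) ℚ) (a : Fin k → Fin k → ℕ) (b c : Fin k → ℕ),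
            r.domain = {t | (∀ i, 0 < t i) ∧ (∀ i, t i < 1) ∧ StrictAnti t} ∧
            Set.EqOn r.integrand (fun t => MvPolynomial.aeval t p / ((∏ i, t i ^ b i) *
              (∏ i, (1 - t i) ^ c i) * ∏ i, ∏ j, if i < j then (t i - t j) ^ a i j else 1))
              r.domain ∧ x = KZ.of r} := by
  constructor
  · intro hRES c hc
    obtain ⟨g, hg, hgc⟩ := AddSubgroup.mem_map.1 hc
    have h0 : KZ.eval (c - g) = 0 := by rw [map_sub, ← hgc, sub_self]
    obtain ⟨c₀, hc₀, hrel⟩ := hRES (c - g) h0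
    have : c = (c - g - c₀) + (g + c₀) := by abel
    rw [this]
    exact AddSubgroup.mem_sup.2 ⟨c - g - c₀, hrel, g + c₀, add_mem hg hc₀, rfl⟩
  · intro h c hc
    have hc' := h c (AddSubgroup.mem_map.2 ⟨0, zero_mem _, by rw [map_zero, hc]⟩)
    obtain ⟨y, hy, z, hz, hyz⟩ := AddSubgroup.mem_sup.1 hc'
    refine ⟨z, hz, ?_⟩
    rwa [← hyz, add_sub_cancel_right]

/-- **Value-class form, one representation.** `ResidualBeyondGenusZero` holds if and only if every
single integral representation `R` whose value is a genus-zero value (the value of some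
`ℤ`-combination of genus-zero representations) is congruent modulo the moves to a genus-zero
combination, `[R] ∈ relations ⊔ closure (genus-zero representations)`. Reduction to
`residualBeyondGenusZero_iff_mem_sup_of_eval_mem` by `exists_sub_of_mem_relations` (every
combination is `≡ [R]`, and `relations ≤ ker eval` transports the value). [folklore] -/
theorem residualBeyondGenusZero_iff_of_mem_sup :
    ResidualBeyondGenusZero ↔
      ∀ ⦃N : ℕ⦄ (R : KZ.IntegralRep N),
        R.value ∈ (AddSubgroup.closure
          {x : KZ.FormalRep | ∃ (k : ℕ) (r : KZ.IntegralRep k)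
            (p : MvPolynomial (Fin k) ℚ) (a : Fin k → Fin k → ℕ) (b c : Fin k → ℕ),
            r.domain = {t | (∀ i, 0 < t i) ∧ (∀ i, t i < 1) ∧ StrictAnti t} ∧
            Set.EqOn r.integrand (fun t => MvPolynomial.aeval t p / ((∏ i, t i ^ b i) *
              (∏ i, (1 - t i) ^ c i) * ∏ i, ∏ j, if i < j then (t i - t j) ^ a i j else 1))
              r.domain ∧ x = KZ.of r}).map KZ.eval →
        KZ.of R ∈ KZ.relations ⊔ AddSubgroup.closure
          {x : KZ.FormalRep | ∃ (k : ℕ) (r : KZ.IntegralRep k)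
            (p : MvPolynomial (Fin k) ℚ) (a : Fin k → Fin k → ℕ) (b c : Fin k → ℕ),
            r.domain = {t | (∀ i, 0 < t i) ∧ (∀ i, t i < 1) ∧ StrictAnti t} ∧
            Set.EqOn r.integrand (fun t => MvPolynomial.aeval t p / ((∏ i, t i ^ b i) *
              (∏ i, (1 - t i) ^ c i) * ∏ i, ∏ j, if i < j then (t i - t j) ^ a i j else 1))
              r.domain ∧ x = KZ.of r} := by
  rw [residualBeyondGenusZero_iff_mem_sup_of_eval_mem]
  constructor
  · intro h N R hR
    exact h (KZ.of R) (by rwa [KZ.eval_of])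
  · intro h c hc
    obtain ⟨N, R, hcR⟩ := exists_sub_of_mem_relations c
    have hker : KZ.eval (c - KZ.of R) = 0 := KZ.relations_le_ker_eval_holds hcR
    rw [map_sub, sub_eq_zero, KZ.eval_of] at hker
    have hR := h R (by rwa [← hker])
    have : c = (c - KZ.of R) + KZ.of R := by abel
    rw [this]
    exact add_mem (AddSubgroup.mem_sup_left hcR) hR

/-- **Saturation form.** `ResidualBeyondGenusZero` holds if and only if the subgroup
`relations ⊔ closure (genus-zero representations)` of `KZ.FormalRep` is saturated with respect to
the evaluation map: `eval⁻¹ (eval (closure genus-zero)) = relations ⊔ closure genus-zero`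
(`AddSubgroup.comap` of `AddSubgroup.map`). The inclusion `⊇` is unconditional — `relations ≤ ker
eval` (soundness, `KZ.relations_le_ker_eval_holds`) and `G ≤ eval⁻¹ (eval G)` — and `⊆` is
`residualBeyondGenusZero_iff_mem_sup_of_eval_mem`. [folklore] -/
theorem residualBeyondGenusZero_iff_comap_map :
    ResidualBeyondGenusZero ↔
      ((AddSubgroup.closure
          {x : KZ.FormalRep | ∃ (k : ℕ) (r : KZ.IntegralRep k)
            (p : MvPolynomial (Fin k) ℚ) (a : Fin k → Fin k → ℕ) (b c : Fin k → ℕ),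
            r.domain = {t | (∀ i, 0 < t i) ∧ (∀ i, t i < 1) ∧ StrictAnti t} ∧
            Set.EqOn r.integrand (fun t => MvPolynomial.aeval t p / ((∏ i, t i ^ b i) *
              (∏ i, (1 - t i) ^ c i) * ∏ i, ∏ j, if i < j then (t i - t j) ^ a i j else 1))
              r.domain ∧ x = KZ.of r}).map KZ.eval).comap KZ.eval =
        KZ.relations ⊔ AddSubgroup.closure
          {x : KZ.FormalRep | ∃ (k : ℕ) (r : KZ.IntegralRep k)
            (p : MvPolynomial (Fin k) ℚ) (a : Fin k → Fin k → ℕ) (b c : Fin k → ℕ),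
            r.domain = {t | (∀ i, 0 < t i) ∧ (∀ i, t i < 1) ∧ StrictAnti t} ∧
            Set.EqOn r.integrand (fun t => MvPolynomial.aeval t p / ((∏ i, t i ^ b i) *
              (∏ i, (1 - t i) ^ c i) * ∏ i, ∏ j, if i < j then (t i - t j) ^ a i j else 1))
              r.domain ∧ x = KZ.of r} := by
  rw [residualBeyondGenusZero_iff_mem_sup_of_eval_mem]
  constructor
  · intro h
    refine le_antisymm (fun c hc => h c (AddSubgroup.mem_comap.1 hc)) (sup_le ?_ ?_)
    · intro c hc
      have h0 : KZ.eval c = 0 := KZ.relations_le_ker_eval_holds hc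
      exact AddSubgroup.mem_comap.2 (AddSubgroup.mem_map.2 ⟨0, zero_mem _, by rw [map_zero, h0]⟩)
    · exact AddSubgroup.le_comap_map _ _
  · intro h c hc
    rw [← h]
    exact AddSubgroup.mem_comap.2 hc


/-- **Rational numbers are genus-zero values, in dimension `0`.** For every `q : ℚ` there is a
genus-zero representation of dimension `0` with value `q`: the domain is the open ordered simplex in
`ℝ⁰` (all of `ℝ⁰`, one point of volume `1`, `KZ.openOrderedSimplex 0`), the integrand the constant
`q = C q / 1` (empty products). This is the base case "`w = 0` gives the rational constants" of the
route's normal forms. [Kontsevich–Zagier 2001, §1.1 (constants); folklore] -/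
theorem exists_genusZero_value_eq_ratCast (q : ℚ) :
    ∃ r : KZ.IntegralRep 0,
      (r.domain = {t | (∀ i, 0 < t i) ∧ (∀ i, t i < 1) ∧ StrictAnti t} ∧
        Set.EqOn r.integrand (fun t => MvPolynomial.aeval t (MvPolynomial.C q) /
          ((∏ i, t i ^ (0 : Fin 0 → ℕ) i) * (∏ i, (1 - t i) ^ (0 : Fin 0 → ℕ) i) *
            ∏ i, ∏ j, if i < j then (t i - t j) ^ (0 : Fin 0 → Fin 0 → ℕ) i j else 1))
          r.domain) ∧ r.value = q := by
  have huniv : KZ.openOrderedSimplex 0 = Set.univ := by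
    ext t
    simp only [KZ.openOrderedSimplex, Set.mem_setOf_eq, Set.mem_univ, iff_true]
    exact ⟨fun i => i.elim0, fun i => i.elim0, fun i => i.elim0⟩
  have hvol : (MeasureTheory.volume : MeasureTheory.Measure (Fin 0 → ℝ)) Set.univ = 1 := by
    rw [MeasureTheory.volume_pi, MeasureTheory.Measure.pi_univ]
    simp
  have hfin : (MeasureTheory.volume : MeasureTheory.Measure (Fin 0 → ℝ))
      (KZ.openOrderedSimplex 0) < ⊤ := by
    rw [huniv, hvol]
    exact ENNReal.one_lt_top
  refine ⟨{ domain := KZ.openOrderedSimplex 0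
            integrand := fun _ => (q : ℝ)
            isSemialgebraic_domain := KZ.isSemialgebraic_openOrderedSimplex 0
            isSemialgebraicFunOn_integrand :=
              (isSemialgebraicFunOn_aeval (KZ.isSemialgebraic_openOrderedSimplex 0)
                (MvPolynomial.C q)).congr fun x _ => by simp
            integrableOn := MeasureTheory.integrableOn_const hfin.ne }, ⟨rfl, ?_⟩, ?_⟩
  · intro t _
    simp
  · simp only [KZ.IntegralRep.value]
    rw [MeasureTheory.setIntegral_const, huniv, MeasureTheory.measureReal_def, hvol]
    simp

/-- **Under the residual, every representation of a rational number is genus-zero modulo the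
moves.** If `ResidualBeyondGenusZero` holds then every integral representation `R` — of any
dimension and any `ℚ`-semialgebraic shape — whose value is a rational number `q` lies in
`relations ⊔ closure (genus-zero representations)`: `q` is a genus-zero value
(`exists_genusZero_value_eq_ratCast`), so `residualBeyondGenusZero_iff_of_mem_sup` applies. A
concrete family of instances of Conjecture 1 (modulo genus zero) that the item asserts.
[folklore] -/
theorem of_mem_sup_of_value_eq_ratCast (hRES : ResidualBeyondGenusZero) {N : ℕ}
    (R : KZ.IntegralRep N) (q : ℚ) (hR : R.value = q) :
    KZ.of R ∈ KZ.relations ⊔ AddSubgroup.closure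
      {x : KZ.FormalRep | ∃ (k : ℕ) (r : KZ.IntegralRep k)
        (p : MvPolynomial (Fin k) ℚ) (a : Fin k → Fin k → ℕ) (b c : Fin k → ℕ),
        r.domain = {t | (∀ i, 0 < t i) ∧ (∀ i, t i < 1) ∧ StrictAnti t} ∧
        Set.EqOn r.integrand (fun t => MvPolynomial.aeval t p / ((∏ i, t i ^ b i) *
          (∏ i, (1 - t i) ^ c i) * ∏ i, ∏ j, if i < j then (t i - t j) ^ a i j else 1))
          r.domain ∧ x = KZ.of r} := by
  obtain ⟨r, ⟨hdom, hint⟩, hval⟩ := exists_genusZero_value_eq_ratCast q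
  refine residualBeyondGenusZero_iff_of_mem_sup.1 hRES R (AddSubgroup.mem_map.2 ⟨KZ.of r, ?_, ?_⟩)
  · exact AddSubgroup.subset_closure ⟨0, r, MvPolynomial.C q, 0, 0, 0, hdom, hint, rfl⟩
  · rw [KZ.eval_of, hval, hR]

end Summit.KontsevichZagierPeriods.ResidualBeyondGenusZero
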